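import Summits.MatrixMultiplication.MatrixMultiplication.Theorems.ObstructionDescentUniversalOccurrenceFour

set_option linter.dupNamespace false
set_option autoImplicit false

/-!
# Obstruction descent — universal occurrence = universal SATURATION ∧ universal TORSION-FREENESS; format `4` is pure torsion
# (decomp-mm · lens 3 · gen 32, seventh kernel, def-free)

`route-MatrixMultiplication-ObstructionDescent`, crux `NoOccurrenceObstruction` (`P_O`, stmt 29040); NODE-g32 §2e/§3.

The SAT/TOR split of the crux (NODE-g30, `semigroup_le_iff_sat_and_tor`, `noOccurrenceObstruction_iff_sat_and_tor`) is lifted to the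
universal-occurrence node of NODE-g32: for every `(m,N)`,

  `UOCC(m,N) ⟺ USAT(m,N) ∧ UTOR(m,N)`  (`uocc_iff_usat_and_utor`),

where `USAT(m,N)` says that every triple occurring (in positive degree) for ANY tensor of format `≤ N` has a positive MULTIPLE occurring for
`⟨m⟩` (polytope level: `Δ(s) ⊆ Δ(⟨m⟩)` for all `s` of format `N`, i.e. `Kron(N,N,N) ⊆ Δ(⟨m⟩)`), and `UTOR(m,N)` says that the holes of
`S(⟨m⟩)` are invisible from format `N` (a triple occurring for some format-`N` tensor, a multiple of which occurs for `⟨m⟩`, occurs for `⟨m⟩`).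
By van den Berg–Christandl–Lysikov–Nieuwboer–Walter–Zuiddam (`Kron(4,4,4) = Δ(⟨4⟩)`, PROVED tree theorem
`vandenBergEtAl2025_unitTensor_four_polytope_maximal_holds`) **`USAT(m,4)` holds for every `m ≥ 4`** (`usat_four`), so in format `4` the
universal threshold is PURE TORSION: `¬UTOR(m,4)` for `m ∈ {4,5}` (`not_utor_four_of_le_five`, the Bürgisser–Ikenmeyer witness), `UTOR(m,4)` for
`m ≥ 7` (`utor_four_of_seven_le`, Lickteig), and **`u(4) = 6 ⟺ UTOR(6,4)`** (`uocc_six_four_iff_utor`): the one open cell of row `4` asks whether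
a triple with `≤ 4` parts can have a multiple in `S(⟨6⟩)` without lying in `S(⟨6⟩)` itself.  For the crux: `P_O ⟸ USAT-family ∧ UTOR-family`
(`noOccurrenceObstruction_of_usat_utor_family`), the first conjunct being implied by unit-tensor polytope maximality at all large formats
(NODE-g30 `sat_family_of_unitTensor_polytope_maximal`), the second the honest residual bet of the node.
No proposition is defined; no `def`; sorry-free; standard axioms.  Nothing here proves `ω = 2`.
[cite: BurgisserIkenmeyer2011, Def. 3.1, Lemma 6.1, §7, Problem 8.3] [cite: vandenBergChristandlLysikovNieuwboerWalterZuiddam2025, §1 after Cor. 1.5]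
[cite: Lickteig1985, p. 95]
-/

noncomputable section

open scoped BigOperators

namespace Summit.MatrixMultiplication.MatrixMultiplication.Theorems.ObstructionCalculus

open Literature.Computability.AlgebraicComplexity (kroneckerPow isotypicSum₁ isotypicSum₂ isotypicSum₃ unitTensor matMulTensor
  vandenBergEtAl2025_unitTensor_four_polytope_maximal_holds)
open Summit.MatrixMultiplication.MatrixMultiplication.Theses.ObstructionDescent (NoOccurrenceObstruction)

/-! ## §1  The split -/

/-- **`UOCC(m,N) ⟺ USAT(m,N) ∧ UTOR(m,N)`**: universal occurrence at `(m,N)` holds iff (USAT) every triple occurring in a positive tensor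
power of any complex tensor of format `≤ N` has a positive multiple occurring in the corresponding power of `⟨m⟩`, and (UTOR) every triple
occurring for such a tensor, some positive multiple of which occurs for `⟨m⟩`, occurs for `⟨m⟩` itself (`semigroup_le_iff_sat_and_tor`
tensor by tensor). [cite: BurgisserIkenmeyer2011, Def. 3.1, §7] -/
theorem uocc_iff_usat_and_utor {m N : ℕ} :
    (∀ {ι : Type} [Fintype ι], Fintype.card ι ≤ N → ∀ (s : ι → ι → ι → ℂ) (d : ℕ)
      (lam : Fin 3 → Nat.Partition d),
      isotypicSum₁ (lam 0) (isotypicSum₂ (lam 1) (isotypicSum₃ (lam 2) (kroneckerPow s d))) ≠ 0 →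
      isotypicSum₁ (lam 0) (isotypicSum₂ (lam 1) (isotypicSum₃ (lam 2) (kroneckerPow (unitTensor ℂ m) d))) ≠ 0) ↔
    (∀ {ι : Type} [Fintype ι], Fintype.card ι ≤ N → ∀ (s : ι → ι → ι → ℂ) (d : ℕ)
      (lam : Fin 3 → Nat.Partition d), 0 < d →
      isotypicSum₁ (lam 0) (isotypicSum₂ (lam 1) (isotypicSum₃ (lam 2) (kroneckerPow s d))) ≠ 0 →
      ∃ (k : ℕ) (mu : Fin 3 → Nat.Partition (k * d)), 0 < k ∧
        (∀ j, (mu j).parts = (lam j).parts.map (fun p => k * p)) ∧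
        isotypicSum₁ (mu 0) (isotypicSum₂ (mu 1) (isotypicSum₃ (mu 2) (kroneckerPow (unitTensor ℂ m) (k * d)))) ≠ 0) ∧
    (∀ {ι : Type} [Fintype ι], Fintype.card ι ≤ N → ∀ (s : ι → ι → ι → ℂ) (d : ℕ)
      (lam : Fin 3 → Nat.Partition d) (k : ℕ) (mu : Fin 3 → Nat.Partition (k * d)), 0 < k →
      (∀ j, (mu j).parts = (lam j).parts.map (fun p => k * p)) →
      isotypicSum₁ (lam 0) (isotypicSum₂ (lam 1) (isotypicSum₃ (lam 2) (kroneckerPow s d))) ≠ 0 →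
      isotypicSum₁ (mu 0) (isotypicSum₂ (mu 1) (isotypicSum₃ (mu 2) (kroneckerPow (unitTensor ℂ m) (k * d)))) ≠ 0 →
      isotypicSum₁ (lam 0) (isotypicSum₂ (lam 1) (isotypicSum₃ (lam 2) (kroneckerPow (unitTensor ℂ m) d))) ≠ 0) := by
  constructor
  · intro hU
    exact ⟨fun hι s => ((semigroup_le_iff_sat_and_tor s (unitTensor ℂ m)).1 (hU hι s)).1,
      fun hι s => ((semigroup_le_iff_sat_and_tor s (unitTensor ℂ m)).1 (hU hι s)).2⟩
  · rintro ⟨hS, hT⟩ ι _ hι s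
    exact (semigroup_le_iff_sat_and_tor s (unitTensor ℂ m)).2 ⟨hS hι s, hT hι s⟩

/-- **`P_O` from the universal SAT-family and the universal TOR-family** along `m₀(n,τ) = max(n², ⌈n^τ⌉)`, `N = n²`
(`uocc_iff_usat_and_utor` + `noOccurrenceObstruction_of_uocc_family`). [cite: BurgisserIkenmeyer2011, Def. 3.1, Problem 8.3] -/
theorem noOccurrenceObstruction_of_usat_utor_family
    (hS : ∀ τ : ℝ, 2 < τ → ∃ n₀ : ℕ, ∀ n : ℕ, n₀ ≤ n →
      ∀ {ι : Type} [Fintype ι], Fintype.card ι ≤ n * n → ∀ (s : ι → ι → ι → ℂ) (d : ℕ)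
        (lam : Fin 3 → Nat.Partition d), 0 < d →
        isotypicSum₁ (lam 0) (isotypicSum₂ (lam 1) (isotypicSum₃ (lam 2) (kroneckerPow s d))) ≠ 0 →
        ∃ (k : ℕ) (mu : Fin 3 → Nat.Partition (k * d)), 0 < k ∧
          (∀ j, (mu j).parts = (lam j).parts.map (fun p => k * p)) ∧
          isotypicSum₁ (mu 0) (isotypicSum₂ (mu 1) (isotypicSum₃ (mu 2)
            (kroneckerPow (unitTensor ℂ (max (n * n) ⌈(n : ℝ) ^ τ⌉₊)) (k * d)))) ≠ 0)
    (hT : ∀ τ : ℝ, 2 < τ → ∃ n₀ : ℕ, ∀ n : ℕ, n₀ ≤ n →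
      ∀ {ι : Type} [Fintype ι], Fintype.card ι ≤ n * n → ∀ (s : ι → ι → ι → ℂ) (d : ℕ)
        (lam : Fin 3 → Nat.Partition d) (k : ℕ) (mu : Fin 3 → Nat.Partition (k * d)), 0 < k →
        (∀ j, (mu j).parts = (lam j).parts.map (fun p => k * p)) →
        isotypicSum₁ (lam 0) (isotypicSum₂ (lam 1) (isotypicSum₃ (lam 2) (kroneckerPow s d))) ≠ 0 →
        isotypicSum₁ (mu 0) (isotypicSum₂ (mu 1) (isotypicSum₃ (mu 2)
          (kroneckerPow (unitTensor ℂ (max (n * n) ⌈(n : ℝ) ^ τ⌉₊)) (k * d)))) ≠ 0 →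
        isotypicSum₁ (lam 0) (isotypicSum₂ (lam 1) (isotypicSum₃ (lam 2)
          (kroneckerPow (unitTensor ℂ (max (n * n) ⌈(n : ℝ) ^ τ⌉₊)) d))) ≠ 0) :
    NoOccurrenceObstruction := by
  refine noOccurrenceObstruction_of_uocc_family fun τ hτ => ?_
  obtain ⟨n₁, hn₁⟩ := hS τ hτ
  obtain ⟨n₂, hn₂⟩ := hT τ hτ
  refine ⟨max n₁ n₂, fun n hn => uocc_iff_usat_and_utor.2 ⟨?_, ?_⟩⟩
  · exact fun hι s => hn₁ n ((le_max_left _ _).trans hn) hι s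
  · exact fun hι s => hn₂ n ((le_max_right _ _).trans hn) hι s

/-! ## §2  Format `4`: saturation is free, the threshold is pure torsion -/

/-- **`USAT(m,4)` for every `m ≥ 4`, unconditionally**: every triple occurring in a positive tensor power of any complex tensor on an index
type of cardinality `≤ 4` has a positive multiple occurring for `⟨4⟩`, hence for `⟨m⟩` — the semigroup form of `Kron(4,4,4) = Δ(⟨4⟩)`
(`vandenBergEtAl2025_unitTensor_four_polytope_maximal_holds`) and format monotonicity.
[cite: vandenBergChristandlLysikovNieuwboerWalterZuiddam2025, §1 after Cor. 1.5] [cite: BurgisserIkenmeyer2011, §3.1] -/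
theorem usat_four {m : ℕ} (hm : 4 ≤ m) {ι : Type} [Fintype ι] (hι : Fintype.card ι ≤ 4) (s : ι → ι → ι → ℂ) (d : ℕ)
    (lam : Fin 3 → Nat.Partition d) (hd : 0 < d)
    (hocc : isotypicSum₁ (lam 0) (isotypicSum₂ (lam 1) (isotypicSum₃ (lam 2) (kroneckerPow s d))) ≠ 0) :
    ∃ (k : ℕ) (mu : Fin 3 → Nat.Partition (k * d)), 0 < k ∧
      (∀ j, (mu j).parts = (lam j).parts.map (fun p => k * p)) ∧
      isotypicSum₁ (mu 0) (isotypicSum₂ (mu 1) (isotypicSum₃ (mu 2) (kroneckerPow (unitTensor ℂ m) (k * d)))) ≠ 0 := by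
  obtain ⟨k, mu, hk, hmu, h4⟩ := vandenBergEtAl2025_unitTensor_four_polytope_maximal_holds hι hι hι s d lam hd hocc
  exact ⟨k, mu, hk, hmu, isotypicSum_kroneckerPow_unitTensor_mono hm mu h4⟩

/-- **`¬UTOR(m,4)` for `4 ≤ m ≤ 5`**: at formats `4` and `5` the failure of universal occurrence from format `4`
(`not_uocc_four_of_le_five`: `λ₂ = ((5,1,1,1),(2⁴),(2⁴)) ∈ S(⟨2,2,2⟩) ∖ S(⟨5⟩)`) is a TORSION failure, saturation being free (`usat_four`):
some multiple of `λ₂` occurs for `⟨4⟩`, `λ₂` does not occur for `⟨5⟩`. [cite: BurgisserIkenmeyer2011, Lemma 6.1, §7]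
[cite: vandenBergChristandlLysikovNieuwboerWalterZuiddam2025, §1] -/
theorem not_utor_four_of_le_five {m : ℕ} (hm4 : 4 ≤ m) (hm5 : m ≤ 5) :
    ¬ (∀ {ι : Type} [Fintype ι], Fintype.card ι ≤ 4 → ∀ (s : ι → ι → ι → ℂ) (d : ℕ)
      (lam : Fin 3 → Nat.Partition d) (k : ℕ) (mu : Fin 3 → Nat.Partition (k * d)), 0 < k →
      (∀ j, (mu j).parts = (lam j).parts.map (fun p => k * p)) →
      isotypicSum₁ (lam 0) (isotypicSum₂ (lam 1) (isotypicSum₃ (lam 2) (kroneckerPow s d))) ≠ 0 →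
      isotypicSum₁ (mu 0) (isotypicSum₂ (mu 1) (isotypicSum₃ (mu 2) (kroneckerPow (unitTensor ℂ m) (k * d)))) ≠ 0 →
      isotypicSum₁ (lam 0) (isotypicSum₂ (lam 1) (isotypicSum₃ (lam 2) (kroneckerPow (unitTensor ℂ m) d))) ≠ 0) :=
  fun hT => not_uocc_four_of_le_five hm5
    (uocc_iff_usat_and_utor.2 ⟨fun hι s d lam hd hocc => usat_four hm4 hι s d lam hd hocc, fun hι s => hT hι s⟩)

/-- **`UTOR(m,4)` for every `m ≥ 7`** (from `UOCC(m,4)`, Lickteig: `uocc_four_of_seven_le'`). [cite: Lickteig1985, p. 95] -/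
theorem utor_four_of_seven_le {m : ℕ} (hm : 7 ≤ m) {ι : Type} [Fintype ι] (hι : Fintype.card ι ≤ 4) (s : ι → ι → ι → ℂ)
    (d : ℕ) (lam : Fin 3 → Nat.Partition d) (k : ℕ) (mu : Fin 3 → Nat.Partition (k * d)) (hk : 0 < k)
    (hmu : ∀ j, (mu j).parts = (lam j).parts.map (fun p => k * p))
    (hocc : isotypicSum₁ (lam 0) (isotypicSum₂ (lam 1) (isotypicSum₃ (lam 2) (kroneckerPow s d))) ≠ 0)
    (hmul : isotypicSum₁ (mu 0) (isotypicSum₂ (mu 1) (isotypicSum₃ (mu 2) (kroneckerPow (unitTensor ℂ m) (k * d)))) ≠ 0) :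
    isotypicSum₁ (lam 0) (isotypicSum₂ (lam 1) (isotypicSum₃ (lam 2) (kroneckerPow (unitTensor ℂ m) d))) ≠ 0 :=
  (uocc_iff_usat_and_utor.1 (uocc_four_of_seven_le' hm)).2 hι s d lam k mu hk hmu hocc hmul

/-- **`u(4) = 6 ⟺ UTOR(6,4)`: the open cell of row `4` is a pure torsion question.**  `UOCC(6,4)` holds iff every triple occurring for a
tensor of format `≤ 4`, some positive multiple of which occurs for `⟨6⟩`, occurs for `⟨6⟩` — saturation `USAT(6,4)` being a theorem
(`usat_four`).  (`UOCC(6,4)` implies the open `P_O`-cell `(2,6)`, `semigroup_le_two_six_of_uocc`.)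
[cite: BurgisserIkenmeyer2011, §7, Problem 8.3] [cite: vandenBergChristandlLysikovNieuwboerWalterZuiddam2025, §1] -/
theorem uocc_six_four_iff_utor :
    (∀ {ι : Type} [Fintype ι], Fintype.card ι ≤ 4 → ∀ (s : ι → ι → ι → ℂ) (d : ℕ)
      (lam : Fin 3 → Nat.Partition d),
      isotypicSum₁ (lam 0) (isotypicSum₂ (lam 1) (isotypicSum₃ (lam 2) (kroneckerPow s d))) ≠ 0 →
      isotypicSum₁ (lam 0) (isotypicSum₂ (lam 1) (isotypicSum₃ (lam 2) (kroneckerPow (unitTensor ℂ 6) d))) ≠ 0) ↔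
    (∀ {ι : Type} [Fintype ι], Fintype.card ι ≤ 4 → ∀ (s : ι → ι → ι → ℂ) (d : ℕ)
      (lam : Fin 3 → Nat.Partition d) (k : ℕ) (mu : Fin 3 → Nat.Partition (k * d)), 0 < k →
      (∀ j, (mu j).parts = (lam j).parts.map (fun p => k * p)) →
      isotypicSum₁ (lam 0) (isotypicSum₂ (lam 1) (isotypicSum₃ (lam 2) (kroneckerPow s d))) ≠ 0 →
      isotypicSum₁ (mu 0) (isotypicSum₂ (mu 1) (isotypicSum₃ (mu 2) (kroneckerPow (unitTensor ℂ 6) (k * d)))) ≠ 0 →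
      isotypicSum₁ (lam 0) (isotypicSum₂ (lam 1) (isotypicSum₃ (lam 2) (kroneckerPow (unitTensor ℂ 6) d))) ≠ 0) :=
  ⟨fun hU => (uocc_iff_usat_and_utor.1 hU).2,
    fun hT => uocc_iff_usat_and_utor.2 ⟨fun hι s d lam hd hocc => usat_four (by norm_num) hι s d lam hd hocc, fun hι s => hT hι s⟩⟩

end Summit.MatrixMultiplication.MatrixMultiplication.Theorems.ObstructionCalculus

end
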